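import Summits.ResolutionOfSingularities.ResolutionOfSingularities.Theorems.MarkedTransferCampaignW13RFlatCanonicalPosRefutation
import HarnessLib

/-!
# [OURS · L1 W1.3] The rung-1 content Prop on `𝒞_can` FAILS ALREADY FOR A SURFACE with an ISOLATED singular point:
# `g = u² + (x₁+x₂)³ + x₁⁵x₂` (p = 2) — and HOLDS for the same singularity in other coordinates (seat res-L1-s13-pv-1, g2)

LADDER-RESOLUTION rung L (rescue), cell `res-hironaka`, RESCUE-SEED slot W1.3 (architecture bypass, reading R-flat), F7′ rows
1 / 2(b). Sequel to `MarkedTransferCampaignW13RFlatCanonicalPosRefutation.lean` (p501051: `¬ CampaignW13RFlatCanonicalPos 2 K x`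
at Narasimhan's fourfold-ambient head). This file sharpens the failure locus in THREE ways, all in the kernel:

(1) **Census regime, surface, isolated singularity.** `K` any field of characteristic `2`, `O = K[x₁,x₂,u]` (`X 0 = x₁`,
`X 1 = x₂`, `X 2 = u` — the chart type `MvPolynomial (Fin 3) K`, tail variable `2`, of the slot's examples D / E2 / N and of the
census j263239/j263697), head `g = u² + ε`, `ε = x₁³ + x₁²x₂ + x₁x₂² + x₂³ + x₁⁵x₂ = (x₁+x₂)³ + x₁⁵x₂`: `ε` is free of `u`,
has NO square monomial, `ord₀ ε = 3 > q = 2`; the datum (`e = 1`, tail `u`, `r = 0`) is CANONICAL (`S_isCanonicalChain`).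
Its order-`2` locus is THE ORIGIN ALONE over every field of characteristic `2` (`S_mem_orderTwoLocus_iff`: `top(g) = {0}`,
so the necessary condition of p501051 §1 — the tail vanishes on `top(g)` — HOLDS here). Nevertheless `u² ∉ ℘_alg(((g),2),1)`
(`S_tail_sq_not_mem`), by the slot's arc criterion p481686 along the arc `γ(t) = (t⁴, t⁴ + t¹⁰, t¹²)` ON the surface:
`g∘γ = 0`, `∂₁g∘γ = t²⁶`, `∂₂g∘γ = 0`, `∂_u g = 0`, while `u²∘γ = t²⁴` is not divisible by `θ = t²⁵`. The stalk-level repair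
fails too (`S_mul_tail_sq_not_mem`: `s·u² ∉ ℘` whenever `s(0) ≠ 0`). Hence `¬ RFlatTailPow` and
**`¬ CampaignW13RFlatCanonicalPos 2 K (2 : Fin 3)`** (`Campaign.not_CampaignW13RFlatCanonicalPos_fin3`) — the content Prop
fails in the census's own chart type; the census (12 255 sparse + 449 dense heads, 0 counterexamples) did not enumerate this
5-monomial degree-6 `ε`. So the failure locus of the R-flat feed is NOT detected by the top locus: it is detected by arcs
tangent to the hypersurface to high order (the valuative criterion proper: `v(g) > 2·v(u²)` and `v(∂_i g) > v(u²)`), i.e. by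
the char-`2` «kangaroo»-type contact of `u = 0` with `g = 0` along `x₂ = x₁ + x₁^{5/2}`.

(2) **Coordinate dependence of `𝒞_can`** is certified in the companion file
`MarkedTransferCampaignW13RFlatCanonicalPosCoordChange.lean`: the same singularity in the coordinates `(x₁, x₁+x₂, u+x₁³)` is
`G = v² + w³ + x₁⁵w`, again a canonical presentation, and there POS HOLDS (`v² = G + w·∂_w G`).

(3) **Reading for the F7′ table** (prover's words; AI bookkeeping weaker than expert review). Row 1 / 2(b) at `𝒞_can`: DEAD as
typed (p501051) and dead on surfaces with isolated singularities (this file); no repair by localisation, by restricting the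
dimension, or by a top-locus side condition; a repair «there EXIST coordinates in which the canonical tail passes» is refuted in
general by Narasimhan (p501051 §4: `Cot_flat ⊆ 𝔪₀²`) and is, where it holds, no longer Hironaka's coordinate-bound cleaning.
W1.3 stays ALIVE only as the banked R-flat theorems (`𝒞_Diff`, A/B/C/D/R2/E2). Caveat of record restated: nothing here bears
on L-G4 / (127) (`KangarooShadeIncrease`).

HONEST FRAMING. Nothing here is a statement of H. Hironaka's manuscript [Hironaka2017] (2017-03-23, lit key
`paper:url-3343fd9e678b`); OURS objects (bypass reading R-flat, `℘` bound algebraic, row 003 U17_2; candidate U17_4 not used).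
AI computation is weaker than expert review; nothing here is progress on resolution of singularities in positive characteristic.
All decls `[folklore]`, sorry-free.
-/

noncomputable section

set_option linter.dupNamespace false -- mandated namespace of this single-conjunct summit

namespace Summit.ResolutionOfSingularities.ResolutionOfSingularities.Theorems.Campaign

open MvPolynomial
open Literature.AlgebraicGeometry.Resolution
open Literature.AlgebraicGeometry.Hironaka2017
open Literature.AlgebraicGeometry.Hironaka2017.S09LLUED (LLChainData)
open Literature.Barriers.ResolutionOfSingularities (orderTwoLocus)

namespace W13

/-! ## §0 Two small generic helpers -/

section Helpers

variable (K : Type) [Field K]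

/-- Along an arc through the origin (`x_i ↦ f_i(t)` with `f_i(0) = 0`) the constant term is preserved:
`(s∘γ)(0) = s(0)`. [folklore] -/
theorem coeff_zero_aeval_of_coeff_zero {σ : Type} (f : σ → Polynomial K) (hf : ∀ i, (f i).coeff 0 = 0)
    (s : MvPolynomial σ K) : (aeval f s).coeff 0 = coeff 0 s := by
  classical
  induction s using MvPolynomial.induction_on with
  | C a => rw [aeval_C, Polynomial.algebraMap_eq, Polynomial.coeff_C_zero, coeff_C, if_pos rfl]
  | add p q hp hq => rw [map_add, Polynomial.coeff_add, coeff_add, hp, hq]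
  | mul_X p i hp => rw [map_mul, aeval_X, Polynomial.mul_coeff_zero, hf i, mul_zero, coeff_mul_X', if_neg (by simp)]

/-- Monomial supports: a sum keeps the property «every exponent vector has an odd entry». [folklore] -/
theorem exists_odd_of_mem_support_add {n : ℕ} {p q : MvPolynomial (Fin n) K}
    (hp : ∀ m ∈ p.support, ∃ i, ¬ 2 ∣ m i) (hq : ∀ m ∈ q.support, ∃ i, ¬ 2 ∣ m i) :
    ∀ m ∈ (p + q).support, ∃ i, ¬ 2 ∣ m i := fun m hm =>
  (Finset.mem_union.mp (support_add hm)).elim (hp m) (hq m)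

/-- … and a monomial with an odd exponent has it. [folklore] -/
theorem exists_odd_of_mem_support_monomial {n : ℕ} (m₀ : Fin n →₀ ℕ) (c : K) (i : Fin n) (hi : ¬ 2 ∣ m₀ i) :
    ∀ m ∈ (monomial m₀ c : MvPolynomial (Fin n) K).support, ∃ j, ¬ 2 ∣ m j := fun m hm => by
  rw [Finset.mem_singleton.mp (support_monomial_subset hm)]
  exact ⟨i, hi⟩

end Helpers

/-! ## §1 The surface `g = u² + (x₁+x₂)³ + x₁⁵x₂` over a field of characteristic `2` -/

section HeadS

open Polynomial (C)

variable (K : Type) [Field K] [CharP K 2]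

/-- First partials of `g = u² + x₁³ + x₁²x₂ + x₁x₂² + x₂³ + x₁⁵x₂` in characteristic `2`:
`∂₁g = x₁² + x₂² + x₁⁴x₂ = (x₁+x₂)² + x₁⁴x₂`, `∂₂g = x₁² + x₂² + x₁⁵ = (x₁+x₂)² + x₁⁵`, `∂_u g = 0`. [folklore] -/
theorem S_pderiv :
    pderiv 0 (X 2 ^ 2 + (X 0 ^ 3 + X 0 ^ 2 * X 1 + X 0 * X 1 ^ 2 + X 1 ^ 3 + X 0 ^ 5 * X 1) :
        MvPolynomial (Fin 3) K) = X 0 ^ 2 + X 1 ^ 2 + X 0 ^ 4 * X 1 ∧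
      pderiv 1 (X 2 ^ 2 + (X 0 ^ 3 + X 0 ^ 2 * X 1 + X 0 * X 1 ^ 2 + X 1 ^ 3 + X 0 ^ 5 * X 1) :
        MvPolynomial (Fin 3) K) = X 0 ^ 2 + X 1 ^ 2 + X 0 ^ 5 ∧
      pderiv 2 (X 2 ^ 2 + (X 0 ^ 3 + X 0 ^ 2 * X 1 + X 0 * X 1 ^ 2 + X 1 ^ 3 + X 0 ^ 5 * X 1) :
        MvPolynomial (Fin 3) K) = 0 := by
  have h2 : (2 : MvPolynomial (Fin 3) K) = 0 := CharTwo.two_eq_zero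
  have h10 : (1 : Fin 3) ≠ 0 := by decide
  have h20 : (2 : Fin 3) ≠ 0 := by decide
  have h01 : (0 : Fin 3) ≠ 1 := by decide
  have h21 : (2 : Fin 3) ≠ 1 := by decide
  have h02 : (0 : Fin 3) ≠ 2 := by decide
  have h12 : (1 : Fin 3) ≠ 2 := by decide
  refine ⟨?_, ?_, ?_⟩
  · simp only [map_add, pderiv_mul, pderiv_pow, pderiv_X_self, pderiv_X_of_ne h10, pderiv_X_of_ne h20, mul_zero,
      zero_add, add_zero, mul_one]
    push_cast
    linear_combination (X 0 ^ 2 + X 0 * X 1 + 2 * X 0 ^ 4 * X 1 : MvPolynomial (Fin 3) K) * h2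
  · simp only [map_add, pderiv_mul, pderiv_pow, pderiv_X_self, pderiv_X_of_ne h01, pderiv_X_of_ne h21, mul_zero,
      zero_add, mul_one, zero_mul]
    push_cast
    linear_combination (X 0 * X 1 + X 1 ^ 2 : MvPolynomial (Fin 3) K) * h2
  · simp only [map_add, pderiv_mul, pderiv_pow, pderiv_X_self, pderiv_X_of_ne h02, pderiv_X_of_ne h12, mul_zero,
      add_zero, mul_one, zero_mul]
    push_cast
    linear_combination (X 2 : MvPolynomial (Fin 3) K) * h2

/-- THE ARC `γ(t) = (x₁, x₂, u) = (t⁴, t⁴ + t¹⁰, t¹²)` lies ON the surface and is tangent to order `26` to `∂₁g = 0`: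
`g∘γ = 0`, `(∂₁g)∘γ = t²⁶`, `(∂₂g)∘γ = 0`, `u²∘γ = t²⁴`. [folklore] -/
theorem S_arc :
    MvPolynomial.aeval ![(Polynomial.X : Polynomial K) ^ 4, Polynomial.X ^ 4 + Polynomial.X ^ 10, Polynomial.X ^ 12]
        (X 2 ^ 2 + (X 0 ^ 3 + X 0 ^ 2 * X 1 + X 0 * X 1 ^ 2 + X 1 ^ 3 + X 0 ^ 5 * X 1) :
          MvPolynomial (Fin 3) K) = 0 ∧
      MvPolynomial.aeval ![(Polynomial.X : Polynomial K) ^ 4, Polynomial.X ^ 4 + Polynomial.X ^ 10, Polynomial.X ^ 12]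
        (X 0 ^ 2 + X 1 ^ 2 + X 0 ^ 4 * X 1 : MvPolynomial (Fin 3) K) = Polynomial.X ^ 26 ∧
      MvPolynomial.aeval ![(Polynomial.X : Polynomial K) ^ 4, Polynomial.X ^ 4 + Polynomial.X ^ 10, Polynomial.X ^ 12]
        (X 0 ^ 2 + X 1 ^ 2 + X 0 ^ 5 : MvPolynomial (Fin 3) K) = 0 ∧
      MvPolynomial.aeval ![(Polynomial.X : Polynomial K) ^ 4, Polynomial.X ^ 4 + Polynomial.X ^ 10, Polynomial.X ^ 12]
        (X 2 ^ 2 : MvPolynomial (Fin 3) K) = Polynomial.X ^ 24 := by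
  have h2 : (2 : Polynomial K) = 0 := CharTwo.two_eq_zero
  refine ⟨?_, ?_, ?_, ?_⟩
  · simp only [map_add, map_pow, map_mul, MvPolynomial.aeval_X, Matrix.cons_val_zero, Matrix.cons_val_one,
      Matrix.cons_val_two, Matrix.tail_cons, Matrix.head_cons]
    linear_combination (2 * Polynomial.X ^ 12 + 3 * Polynomial.X ^ 18 + 3 * Polynomial.X ^ 24 + Polynomial.X ^ 30 :
      Polynomial K) * h2
  · simp only [map_add, map_pow, map_mul, MvPolynomial.aeval_X, Matrix.cons_val_zero, Matrix.cons_val_one]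
    linear_combination (Polynomial.X ^ 8 + Polynomial.X ^ 14 + Polynomial.X ^ 20 : Polynomial K) * h2
  · simp only [map_add, map_pow, MvPolynomial.aeval_X, Matrix.cons_val_zero, Matrix.cons_val_one]
    linear_combination (Polynomial.X ^ 8 + Polynomial.X ^ 14 + Polynomial.X ^ 20 : Polynomial K) * h2
  · simp only [map_pow, MvPolynomial.aeval_X, Matrix.cons_val_two, Matrix.tail_cons, Matrix.head_cons]
    ring

/-- **`u² ∉ ℘_alg(((g),2),1)`** for the surface `g = u² + (x₁+x₂)³ + x₁⁵x₂`, `char K = 2` (bound algebraic `℘`, row 003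
U17_2) — arc criterion p481686 with `γ = (t⁴, t⁴+t¹⁰, t¹²)`, `θ = t²⁵`: `t²⁵ ∣ t²⁶, 0, 0` but `t²⁵ ∤ t²⁴`. [folklore] -/
theorem S_tail_sq_not_mem :
    (X 2 : MvPolynomial (Fin 3) K) ^ 2 ∉
      Campaign.pAlgPiece K (Ideal.span {(X 2 ^ 2 + (X 0 ^ 3 + X 0 ^ 2 * X 1 + X 0 * X 1 ^ 2 + X 1 ^ 3 + X 0 ^ 5 * X 1) :
        MvPolynomial (Fin 3) K)}) 2 1 := by
  obtain ⟨hg, h1, h1', hu⟩ := S_arc K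
  obtain ⟨d0, d1, d2⟩ := S_pderiv K
  refine not_mem_pAlgPiece_one_of_arc K
    (MvPolynomial.aeval ![(Polynomial.X : Polynomial K) ^ 4, Polynomial.X ^ 4 + Polynomial.X ^ 10,
      Polynomial.X ^ 12]).toRingHom
    (θ := Polynomial.X ^ 25) (pow_ne_zero 25 Polynomial.X_ne_zero) _ hg ?_ ?_
  · intro i
    fin_cases i
    · change Polynomial.X ^ 25 ∣ MvPolynomial.aeval _ (pderiv 0 _)
      rw [d0, h1]
      exact pow_dvd_pow _ (by norm_num)
    · change Polynomial.X ^ 25 ∣ MvPolynomial.aeval _ (pderiv 1 _)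
      rw [d1, h1']
      exact dvd_zero _
    · change Polynomial.X ^ 25 ∣ MvPolynomial.aeval _ (pderiv 2 _)
      rw [d2, map_zero]
      exact dvd_zero _
  · change ¬ Polynomial.X ^ 25 ∣ MvPolynomial.aeval _ (X 2 ^ 2)
    rw [hu]
    intro h
    have := Polynomial.natDegree_le_of_dvd h (pow_ne_zero 24 Polynomial.X_ne_zero)
    rw [Polynomial.natDegree_X_pow, Polynomial.natDegree_X_pow] at this
    omega

/-- **The stalk-level form fails too**: `s·u² ∉ ℘_alg(((g),2),1)` for every `s` with `s(0) ≠ 0` — the arc passes through the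
origin, so `s∘γ` is a unit of `K[[t]]` and `t²⁵ ∤ (s∘γ)·t²⁴`. [folklore] -/
theorem S_mul_tail_sq_not_mem (s : MvPolynomial (Fin 3) K) (hs : coeff 0 s ≠ 0) :
    s * X 2 ^ 2 ∉
      Campaign.pAlgPiece K (Ideal.span {(X 2 ^ 2 + (X 0 ^ 3 + X 0 ^ 2 * X 1 + X 0 * X 1 ^ 2 + X 1 ^ 3 + X 0 ^ 5 * X 1) :
        MvPolynomial (Fin 3) K)}) 2 1 := by
  obtain ⟨hg, h1, h1', hu⟩ := S_arc K
  obtain ⟨d0, d1, d2⟩ := S_pderiv K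
  have hf : ∀ i, ((![(Polynomial.X : Polynomial K) ^ 4, Polynomial.X ^ 4 + Polynomial.X ^ 10, Polynomial.X ^ 12]) i).coeff
      0 = 0 := by
    intro i
    fin_cases i <;> simp [Polynomial.coeff_X_pow]
  refine not_mem_pAlgPiece_one_of_arc K
    (MvPolynomial.aeval ![(Polynomial.X : Polynomial K) ^ 4, Polynomial.X ^ 4 + Polynomial.X ^ 10,
      Polynomial.X ^ 12]).toRingHom
    (θ := Polynomial.X ^ 25) (pow_ne_zero 25 Polynomial.X_ne_zero) _ hg ?_ ?_
  · intro i
    fin_cases i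
    · change Polynomial.X ^ 25 ∣ MvPolynomial.aeval _ (pderiv 0 _)
      rw [d0, h1]
      exact pow_dvd_pow _ (by norm_num)
    · change Polynomial.X ^ 25 ∣ MvPolynomial.aeval _ (pderiv 1 _)
      rw [d1, h1']
      exact dvd_zero _
    · change Polynomial.X ^ 25 ∣ MvPolynomial.aeval _ (pderiv 2 _)
      rw [d2, map_zero]
      exact dvd_zero _
  · change ¬ Polynomial.X ^ 25 ∣ MvPolynomial.aeval _ (s * X 2 ^ 2)
    rw [map_mul, hu, pow_succ, mul_comm (Polynomial.X ^ 24)]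
    intro h
    have h' : Polynomial.X ∣ MvPolynomial.aeval
        ![(Polynomial.X : Polynomial K) ^ 4, Polynomial.X ^ 4 + Polynomial.X ^ 10, Polynomial.X ^ 12] s :=
      (mul_dvd_mul_iff_right (pow_ne_zero 24 Polynomial.X_ne_zero)).mp
        (by simpa [mul_comm] using h)
    rw [Polynomial.X_dvd_iff, coeff_zero_aeval_of_coeff_zero K _ hf] at h'
    exact hs h'

omit [CharP K 2] in
/-- **The datum is CANONICAL** (`𝒞_can`): head `u² + ε`, `e = 1`, tail `u`, `r = 0`; `ε = x₁³ + x₁²x₂ + x₁x₂² + x₂³ + x₁⁵x₂`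
is free of `u` and each of its five monomials has an odd exponent (no square monomial; `ord ε = 3 > q`). [folklore] -/
theorem S_isCanonicalChain (d : LLChainData (MvPolynomial (Fin 3) K))
    (hdg : d.g 0 = X 2 ^ 2 + (X 0 ^ 3 + X 0 ^ 2 * X 1 + X 0 * X 1 ^ 2 + X 1 ^ 3 + X 0 ^ 5 * X 1))
    (hde : d.e = 1) (hdt : d.tail = X 2) :
    IsCanonicalChain 2 K (2 : Fin 3) d := by
  have hx0 : (X 0 : MvPolynomial (Fin 3) K) ∈ supported K ({2}ᶜ : Set (Fin 3)) :=
    (X_mem_supported (R := K)).mpr (by decide)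
  have hx1 : (X 1 : MvPolynomial (Fin 3) K) ∈ supported K ({2}ᶜ : Set (Fin 3)) :=
    (X_mem_supported (R := K)).mpr (by decide)
  refine ⟨X 0 ^ 3 + X 0 ^ 2 * X 1 + X 0 * X 1 ^ 2 + X 1 ^ 3 + X 0 ^ 5 * X 1, 0, ?_, by simp, ?_,
    by rw [hdt, add_zero], ?_⟩
  · exact not_mem_vars_of_mem_supported (add_mem (add_mem (add_mem (add_mem (pow_mem hx0 3)
      (mul_mem (pow_mem hx0 2) hx1)) (mul_mem hx0 (pow_mem hx1 2))) (pow_mem hx1 3)) (mul_mem (pow_mem hx0 5) hx1))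
  · rw [hdg, hde, pow_one]
  · rw [hde, pow_one, zero_pow two_ne_zero, sub_zero, X_pow_eq_monomial, X_pow_eq_monomial, X_pow_eq_monomial,
      X_pow_eq_monomial, X_pow_eq_monomial, X, X, monomial_mul, monomial_mul, monomial_mul]
    refine exists_odd_of_mem_support_add K (exists_odd_of_mem_support_add K (exists_odd_of_mem_support_add K
      (exists_odd_of_mem_support_add K ?_ ?_) ?_) ?_) ?_
    · exact exists_odd_of_mem_support_monomial K _ _ 0 (by rw [Finsupp.single_eq_same]; decide)
    · exact exists_odd_of_mem_support_monomial K _ _ 1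
        (by rw [Finsupp.add_apply, Finsupp.single_eq_of_ne (by decide), Finsupp.single_eq_same]; decide)
    · exact exists_odd_of_mem_support_monomial K _ _ 0
        (by rw [Finsupp.add_apply, Finsupp.single_eq_same, Finsupp.single_eq_of_ne (by decide)]; decide)
    · exact exists_odd_of_mem_support_monomial K _ _ 1 (by rw [Finsupp.single_eq_same]; decide)
    · exact exists_odd_of_mem_support_monomial K _ _ 0
        (by rw [Finsupp.add_apply, Finsupp.single_eq_same, Finsupp.single_eq_of_ne (by decide)]; decide)

/-- **`¬ RFlatTailPow`** (v4 schema) for every chain datum on this surface with `e = 1` and the canonical tail `u`.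
[folklore] -/
theorem S_not_rFlatTailPow (d : LLChainData (MvPolynomial (Fin 3) K))
    (hdg : d.g 0 = X 2 ^ 2 + (X 0 ^ 3 + X 0 ^ 2 * X 1 + X 0 * X 1 ^ 2 + X 1 ^ 3 + X 0 ^ 5 * X 1))
    (hde : d.e = 1) (hdt : d.tail = X 2) :
    ¬ Campaign.RFlatTailPow 2 K (Ideal.span {d.g 0}) (2 ^ d.e) d := by
  rw [Campaign.RFlatTailPow, hdg, hde, hdt, pow_one]
  exact S_tail_sq_not_mem K

/-- **`top(g) = {0}`**: over every field of characteristic `2` the order-`2` locus of the surface (barrier file's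
`orderTwoLocus`: `g(P) = 0` and all `∂_i g(P) = 0`) is the origin alone — an ISOLATED singular point, on which the tail `u`
vanishes. The necessary condition of p501051 §1 holds; POS fails regardless. [folklore] -/
theorem S_mem_orderTwoLocus_iff (P : Fin 3 → K) :
    P ∈ orderTwoLocus (X 2 ^ 2 + (X 0 ^ 3 + X 0 ^ 2 * X 1 + X 0 * X 1 ^ 2 + X 1 ^ 3 + X 0 ^ 5 * X 1) :
        MvPolynomial (Fin 3) K) ↔ P = 0 := by
  obtain ⟨d0, d1, d2⟩ := S_pderiv K
  have h2 : (2 : K) = 0 := CharTwo.two_eq_zero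
  constructor
  · rintro ⟨hP, hd⟩
    have e0 := hd 0
    have e1 := hd 1
    rw [d0] at e0
    rw [d1] at e1
    simp only [map_add, map_pow, map_mul, eval_X] at e0 e1 hP
    have e3 : P 0 ^ 4 * (P 0 - P 1) = 0 := by linear_combination e1 - e0
    have hP0 : P 0 = 0 := by
      rcases mul_eq_zero.mp e3 with h | h
      · exact (pow_eq_zero_iff (by norm_num)).mp h
      · have h01 : P 0 = P 1 := sub_eq_zero.mp h
        rw [h01] at e1
        have e4 : P 1 ^ 5 = 0 := by linear_combination e1 - (P 1 ^ 2) * h2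
        have hP1 : P 1 = 0 := (pow_eq_zero_iff (by norm_num)).mp e4
        rw [h01, hP1]
    rw [hP0] at e0
    have hP1 : P 1 = 0 := by
      have e5 : P 1 ^ 2 = 0 := by linear_combination e0
      exact (pow_eq_zero_iff two_ne_zero).mp e5
    rw [hP0, hP1] at hP
    have hP2 : P 2 = 0 := by
      have e6 : P 2 ^ 2 = 0 := by linear_combination hP
      exact (pow_eq_zero_iff two_ne_zero).mp e6
    funext i
    fin_cases i
    · exact hP0
    · exact hP1
    · exact hP2
  · rintro rfl
    refine ⟨by simp, fun i => ?_⟩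
    match i with
    | 0 => rw [d0]; simp
    | 1 => rw [d1]; simp
    | 2 => rw [d2, map_zero]

end HeadS

end W13

/-! ## §2 The content Prop fails in the census chart type `K[x₁,x₂,u]`, tail variable `2` -/

section HeadlineFin3

/-- **REFUTATION of `Campaign.CampaignW13RFlatCanonicalPos 2 K (2 : Fin 3)`** — the instance in which the slot's examples
A/D/E2/N live (p483887) — over every field of characteristic `2`, by the SURFACE `u² + (x₁+x₂)³ + x₁⁵x₂` with an isolated
singular point (`W13.S_not_rFlatTailPow`, `W13.S_mem_orderTwoLocus_iff`). [folklore] -/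
theorem not_CampaignW13RFlatCanonicalPos_fin3 (K : Type) [Field K] [CharP K 2] :
    ¬ CampaignW13RFlatCanonicalPos 2 K (2 : Fin 3) := by
  intro h
  have key : ∀ d : LLChainData (MvPolynomial (Fin 3) K),
      d.g 0 = X 2 ^ 2 + (X 0 ^ 3 + X 0 ^ 2 * X 1 + X 0 * X 1 ^ 2 + X 1 ^ 3 + X 0 ^ 5 * X 1) → d.e = 1 →
        d.tail = X 2 → False :=
    fun d hdg hde hdt => W13.S_not_rFlatTailPow K d hdg hde hdt (h d (W13.S_isCanonicalChain K d hdg hde hdt))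
  exact key ⟨1, fun _ => X 2,
      fun j => if j = 0 then X 2 ^ 2 + (X 0 ^ 3 + X 0 ^ 2 * X 1 + X 0 * X 1 ^ 2 + X 1 ^ 3 + X 0 ^ 5 * X 1) else X 2,
      fun _ => X 0 ^ 3 + X 0 ^ 2 * X 1 + X 0 * X 1 ^ 2 + X 1 ^ 3 + X 0 ^ 5 * X 1, fun _ => 0, fun _ => 3⟩
    (by show (if (0 : ℕ) = 0 then X 2 ^ 2 + (X 0 ^ 3 + X 0 ^ 2 * X 1 + X 0 * X 1 ^ 2 + X 1 ^ 3 + X 0 ^ 5 * X 1)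
          else (X 2 : MvPolynomial (Fin 3) K)) =
          X 2 ^ 2 + (X 0 ^ 3 + X 0 ^ 2 * X 1 + X 0 * X 1 ^ 2 + X 1 ^ 3 + X 0 ^ 5 * X 1)
        exact if_pos rfl)
    rfl
    (by show (if (1 : ℕ) = 0 then X 2 ^ 2 + (X 0 ^ 3 + X 0 ^ 2 * X 1 + X 0 * X 1 ^ 2 + X 1 ^ 3 + X 0 ^ 5 * X 1)
          else (X 2 : MvPolynomial (Fin 3) K)) = X 2
        exact if_neg one_ne_zero)

/-- The `𝔽₂` instance in the census chart type. [folklore] -/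
theorem not_CampaignW13RFlatCanonicalPos_fin3_zmod2 : ¬ CampaignW13RFlatCanonicalPos 2 (ZMod 2) (2 : Fin 3) :=
  not_CampaignW13RFlatCanonicalPos_fin3 (ZMod 2)

end HeadlineFin3

end Summit.ResolutionOfSingularities.ResolutionOfSingularities.Theorems.Campaign

end
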